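import Summits.HubbardSuperconductivity.HubbardSuperconductivity.Theorems.CooperPairDMottWalkBindingWalkQuantumNumbers
import Summits.HubbardSuperconductivity.HubbardSuperconductivity.Theorems.CooperPairDMottWalkBindingWalkAmplitudeLaw
import Literature.MathematicalPhysics.QuantumLattice.HubbardRingPerronFrobeniusProofs

/-!
# Route `CooperPairDMottWalk`, crux `BindingWalk` (stmt-HubbardSuperconductivity-1176):
# the Cooper-pair package is identically FALSE on the `4 × 4` torus (every `t`, every `U`)

Helper file (`--supports stmt-HubbardSuperconductivity-1176`) for the registered line
`Cruxes/BindingWalk/Lines/birth.lean` (stub `stub_dWaveSelection`, S3, and the target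
`PureCooperPair` it feeds). The route's package `CP L H ε z` — (a) two-hole binding, (b) a unique
`(L²-2, S^z = 0)` floor, (c) `z L² ‖φ₀‖²‖φ₂‖² ≤ |⟨φ₂, Δ_d φ₀⟩|²` — is asked eventually in `k` on the
tori of side `L = 4k + 4`. **`not_cooperPackage_four`** (registered sub-goal stub; binder form
`not_cooperPackage_four'`): for every `t`, every `U` (either sign), every `ε` and every `z > 0`,
`CP 4 (hubbardTorus 2 4 t U) ε z` is false. Reason: the `4 × 4` torus `C₄ × C₄` is the HYPERCUBE
`Q₄` (`C₄ ≅ Q₂` by the Gray code `0,1,2,3 ↦ 00,01,11,10`); the three bit swaps `gA`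
(`x`-intra ↔ `y`-inter), `gB` (`x`-inter ↔ `y`-intra), `gC` (`x`-inter ↔ `x`-intra) are explicit
site involutions and graph automorphisms (`decide`), hence symmetries of `hubbardTorus 2 4 t U`
permuting the four classes `X₁, X₂, Y₁, Y₂` of ordered bonds (`decide`); the pair field is
`Δ_d = (1/√2)((D₁ + D₂) - (D₃ + D₄))` in the bond-class sums (`pairField_dWave_four_eq`), a
vector of the standard representation of `S₄`; an amplitude `X ↦ ⟨φ₂, X φ₀⟩` between
NON-DEGENERATE floors transforms by scalars under the swaps
(`dotProduct_mulVec_eq_of_fockRelabel_eigen`), so Schur (`dWave_combination_eq_zero`) kills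
`⟨φ₂, Δ_d φ₀⟩` (`pairField_dWave_amplitude_eq_zero_four`); clause (b) and the non-degeneracy of the
half-filled floor forced by (c) (`halfFilled_groundStates_smul_of_cooperPackage`) contradict (c).
Consequences: `cooperPackage_threshold_pos` (`k₀ ≥ 1` in "`∀ k ≥ k₀, CP (4k+4) …`" with `z > 0`) and
`pureCooperPair_threshold_pos` (read off the target by name): the only exactly diagonalisable
member of the family is structurally silent about the package at the pure point (on the breathing
family `a ≠ b` only the weight-preserving swaps survive and the argument does not apply) — the
rigorous form of the three-fold two-hole ground-state degeneracy of the homogeneous `4 × 4`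
cluster ("three-fold degenerate when t′ = t and M = 2; lifted whenever t′ ≠ t").

References: W.-F. Tsai, H. Yao, A. Läuchli, S. A. Kivelson, PRB 77 (2008) 214502, p. 5;
G. Fano, F. Ortolani, A. Parola, PRB 42 (1990) 6877 (hidden symmetry of the `4 × 4` cluster);
D. J. Scalapino, Phys. Rep. 250 (1995) 329, §2. Finite combinatorics (`decide` on 16 sites) and
linear algebra over tree theorems; no definition and no named fact (site maps and bond classes are
local notation).
-/

set_option linter.dupNamespace false

noncomputable section

namespace Summit.HubbardSuperconductivity.HubbardSuperconductivity.Theorems.CooperPairDMottWalk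

open Matrix Finset Literature.MathematicalPhysics.QuantumLattice Literature.Probability.LatticeModels
open Literature.MathematicalPhysics.QuantumLattice.PairChirality (bond)
open scoped ComplexOrder

/-! ### The side `4`: hypercube bit swaps, bond classes and the `d`-wave pair field -/

section Four

/-- The bit swap `a₂ ↔ b₁` of the hypercube coordinates (`x`-intra ↔ `y`-inter directions), as
a site map of the `4 × 4` torus (table). -/
local notation "gaF" => (fun x : FermionTorus 2 4 => toLex
  ![(![![0, 0, 1, 1], ![0, 0, 1, 1], ![3, 3, 2, 2], ![3, 3, 2, 2]] : Fin 4 → Fin 4 → Fin 4)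
      (ofLex x 0) (ofLex x 1),
    (![![0, 1, 1, 0], ![3, 2, 2, 3], ![3, 2, 2, 3], ![0, 1, 1, 0]] : Fin 4 → Fin 4 → Fin 4)
      (ofLex x 0) (ofLex x 1)])

/-- The bit swap `a₁ ↔ b₂` (`x`-inter ↔ `y`-intra directions). -/
local notation "gbF" => (fun x : FermionTorus 2 4 => toLex
  ![(![![0, 3, 3, 0], ![1, 2, 2, 1], ![1, 2, 2, 1], ![0, 3, 3, 0]] : Fin 4 → Fin 4 → Fin 4)
      (ofLex x 0) (ofLex x 1),
    (![![0, 0, 3, 3], ![0, 0, 3, 3], ![1, 1, 2, 2], ![1, 1, 2, 2]] : Fin 4 → Fin 4 → Fin 4)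
      (ofLex x 0) (ofLex x 1)])

/-- The bit swap `a₁ ↔ a₂` (`x`-inter ↔ `x`-intra): the axis reflection `x₀ ↦ -x₀`. -/
local notation "gcF" => (fun x : FermionTorus 2 4 => toLex
  ![(![![0, 0, 0, 0], ![3, 3, 3, 3], ![2, 2, 2, 2], ![1, 1, 1, 1]] : Fin 4 → Fin 4 → Fin 4)
      (ofLex x 0) (ofLex x 1),
    (![![0, 1, 2, 3], ![0, 1, 2, 3], ![0, 1, 2, 3], ![0, 1, 2, 3]] : Fin 4 → Fin 4 → Fin 4)
      (ofLex x 0) (ofLex x 1)])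

/-- Ordered `x`-bonds between different plaquettes (hypercube direction `a₁`). -/
local notation "X₁" => (Finset.univ.filter fun p : FermionTorus 2 4 × FermionTorus 2 4 =>
  ofLex (Prod.fst p) 1 = ofLex (Prod.snd p) 1 ∧
    ((ofLex (Prod.fst p) 0 = 1 ∧ ofLex (Prod.snd p) 0 = 2) ∨ (ofLex (Prod.fst p) 0 = 2 ∧ ofLex (Prod.snd p) 0 = 1) ∨
     (ofLex (Prod.fst p) 0 = 3 ∧ ofLex (Prod.snd p) 0 = 0) ∨ (ofLex (Prod.fst p) 0 = 0 ∧ ofLex (Prod.snd p) 0 = 3)))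

/-- Ordered `x`-bonds inside the plaquettes (hypercube direction `a₂`). -/
local notation "X₂" => (Finset.univ.filter fun p : FermionTorus 2 4 × FermionTorus 2 4 =>
  ofLex (Prod.fst p) 1 = ofLex (Prod.snd p) 1 ∧
    ((ofLex (Prod.fst p) 0 = 0 ∧ ofLex (Prod.snd p) 0 = 1) ∨ (ofLex (Prod.fst p) 0 = 1 ∧ ofLex (Prod.snd p) 0 = 0) ∨
     (ofLex (Prod.fst p) 0 = 2 ∧ ofLex (Prod.snd p) 0 = 3) ∨ (ofLex (Prod.fst p) 0 = 3 ∧ ofLex (Prod.snd p) 0 = 2)))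

/-- Ordered `y`-bonds between different plaquettes (hypercube direction `b₁`). -/
local notation "Y₁" => (Finset.univ.filter fun p : FermionTorus 2 4 × FermionTorus 2 4 =>
  ofLex (Prod.fst p) 0 = ofLex (Prod.snd p) 0 ∧
    ((ofLex (Prod.fst p) 1 = 1 ∧ ofLex (Prod.snd p) 1 = 2) ∨ (ofLex (Prod.fst p) 1 = 2 ∧ ofLex (Prod.snd p) 1 = 1) ∨
     (ofLex (Prod.fst p) 1 = 3 ∧ ofLex (Prod.snd p) 1 = 0) ∨ (ofLex (Prod.fst p) 1 = 0 ∧ ofLex (Prod.snd p) 1 = 3)))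

/-- Ordered `y`-bonds inside the plaquettes (hypercube direction `b₂`). -/
local notation "Y₂" => (Finset.univ.filter fun p : FermionTorus 2 4 × FermionTorus 2 4 =>
  ofLex (Prod.fst p) 0 = ofLex (Prod.snd p) 0 ∧
    ((ofLex (Prod.fst p) 1 = 0 ∧ ofLex (Prod.snd p) 1 = 1) ∨ (ofLex (Prod.fst p) 1 = 1 ∧ ofLex (Prod.snd p) 1 = 0) ∨
     (ofLex (Prod.fst p) 1 = 2 ∧ ofLex (Prod.snd p) 1 = 3) ∨ (ofLex (Prod.fst p) 1 = 3 ∧ ofLex (Prod.snd p) 1 = 2)))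

/-- `gaF` is an involution. [folklore] -/
theorem ga_involutive : Function.Involutive gaF := by
  unfold Function.Involutive; decide

/-- `gbF` is an involution. [folklore] -/
theorem gb_involutive : Function.Involutive gbF := by
  unfold Function.Involutive; decide

/-- `gcF` is an involution. [folklore] -/
theorem gc_involutive : Function.Involutive gcF := by
  unfold Function.Involutive; decide

/-- The three bit swaps as site permutations. -/
local notation "gA" => Function.Involutive.toPerm gaF ga_involutive
local notation "gB" => Function.Involutive.toPerm gbF gb_involutive
local notation "gC" => Function.Involutive.toPerm gcF gc_involutive

/-- **`gA` is an automorphism of the `4 × 4` torus graph** (it is a coordinate permutation of the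
hypercube `Q₄ = C₄ × C₄`). [cite: TsaiYaoLauchliKivelson2008, p. 5] -/
theorem ga_adj_iff : ∀ x y : FermionTorus 2 4,
    (fermionTorusGraph 2 4).Adj (gA x) (gA y) ↔ (fermionTorusGraph 2 4).Adj x y := by
  decide

/-- `gB` is an automorphism of the `4 × 4` torus graph. [cite: TsaiYaoLauchliKivelson2008, p. 5] -/
theorem gb_adj_iff : ∀ x y : FermionTorus 2 4,
    (fermionTorusGraph 2 4).Adj (gB x) (gB y) ↔ (fermionTorusGraph 2 4).Adj x y := by
  decide

/-- `gC` is an automorphism of the `4 × 4` torus graph. [folklore] -/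
theorem gc_adj_iff : ∀ x y : FermionTorus 2 4,
    (fermionTorusGraph 2 4).Adj (gC x) (gC y) ↔ (fermionTorusGraph 2 4).Adj x y := by
  decide

/-- `gA` fixes the `x`-inter bond class. [folklore] -/
theorem ga_map_X₁ : Finset.map (Equiv.toEmbedding (Equiv.prodCongr gA gA)) X₁ = X₁ := by decide

/-- `gA` carries the `x`-intra bonds onto the `y`-inter bonds. [folklore] -/
theorem ga_map_X₂ : Finset.map (Equiv.toEmbedding (Equiv.prodCongr gA gA)) X₂ = Y₁ := by decide

/-- `gA` carries the `y`-inter bonds onto the `x`-intra bonds. [folklore] -/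
theorem ga_map_Y₁ : Finset.map (Equiv.toEmbedding (Equiv.prodCongr gA gA)) Y₁ = X₂ := by decide

/-- `gA` fixes the `y`-intra bond class. [folklore] -/
theorem ga_map_Y₂ : Finset.map (Equiv.toEmbedding (Equiv.prodCongr gA gA)) Y₂ = Y₂ := by decide

/-- `gB` carries the `x`-inter bonds onto the `y`-intra bonds. [folklore] -/
theorem gb_map_X₁ : Finset.map (Equiv.toEmbedding (Equiv.prodCongr gB gB)) X₁ = Y₂ := by decide

/-- `gB` fixes the `x`-intra bond class. [folklore] -/
theorem gb_map_X₂ : Finset.map (Equiv.toEmbedding (Equiv.prodCongr gB gB)) X₂ = X₂ := by decide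

/-- `gB` carries the `y`-intra bonds onto the `x`-inter bonds. [folklore] -/
theorem gb_map_Y₂ : Finset.map (Equiv.toEmbedding (Equiv.prodCongr gB gB)) Y₂ = X₁ := by decide

/-- `gC` carries the `x`-inter bonds onto the `x`-intra bonds. [folklore] -/
theorem gc_map_X₁ : Finset.map (Equiv.toEmbedding (Equiv.prodCongr gC gC)) X₁ = X₂ := by decide

/-- `gC` carries the `x`-intra bonds onto the `x`-inter bonds. [folklore] -/
theorem gc_map_X₂ : Finset.map (Equiv.toEmbedding (Equiv.prodCongr gC gC)) X₂ = X₁ := by decide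

/-- The local `d`-wave pair operator at a site of the `4 × 4` torus, written with bond pairs:
`P_x = (1/√2)(b_{x,x+e₁} + b_{x,x-e₁}) - (1/√2)(b_{x,x+e₂} + b_{x,x-e₂})`.
[cite: Scalapino1995, §2 eq. (2.2)–(2.3)] -/
theorem localPair_dWave_four_eq (x : TorusSite 2 4) :
    localPair dWaveFormFactor 4 x =
      ((1 / Real.sqrt 2 : ℝ) : ℂ) •
          (bond (FermionTorus.ofTorusSite x)
              (FermionTorus.ofTorusSite (x + Torus.proj 4 (Pi.single 0 1))) +
            bond (FermionTorus.ofTorusSite x)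
              (FermionTorus.ofTorusSite (x + Torus.proj 4 (-Pi.single 0 1)))) -
        ((1 / Real.sqrt 2 : ℝ) : ℂ) •
          (bond (FermionTorus.ofTorusSite x)
              (FermionTorus.ofTorusSite (x + Torus.proj 4 (Pi.single 1 1))) +
            bond (FermionTorus.ofTorusSite x)
              (FermionTorus.ofTorusSite (x + Torus.proj 4 (-Pi.single 1 1)))) := by
  have h00 : (0 : Site 2) ∉ unitSteps := by decide
  have h01 : (Pi.single 0 1 : Site 2) ∉
      ({-Pi.single 0 1, Pi.single 1 1, -Pi.single 1 1} : Finset (Site 2)) := by decide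
  have h02 : (-Pi.single 0 1 : Site 2) ∉ ({Pi.single 1 1, -Pi.single 1 1} : Finset (Site 2)) := by
    decide
  have h03 : (Pi.single 1 1 : Site 2) ∉ ({-Pi.single 1 1} : Finset (Site 2)) := by decide
  have ne1 : (Pi.single 1 1 : Site 2) ≠ Pi.single 0 1 := by decide
  have ne2 : (Pi.single 1 1 : Site 2) ≠ -Pi.single 0 1 := by decide
  have ne3 : (-Pi.single 1 1 : Site 2) ≠ Pi.single 0 1 := by decide
  have ne4 : (-Pi.single 1 1 : Site 2) ≠ -Pi.single 0 1 := by decide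
  have g1 : dWaveFormFactor (Pi.single 0 1) = 1 := by simp [dWaveFormFactor]
  have g2 : dWaveFormFactor (-Pi.single 0 1) = 1 := by simp [dWaveFormFactor]
  have g3 : dWaveFormFactor (Pi.single 1 1) = -1 := by simp [dWaveFormFactor, ne1, ne2]
  have g4 : dWaveFormFactor (-Pi.single 1 1) = -1 := by simp [dWaveFormFactor, ne3, ne4]
  have hdef : localPair dWaveFormFactor 4 x = ∑ e ∈ insert 0 unitSteps,
      ((dWaveFormFactor e / Real.sqrt 2 : ℝ) : ℂ) •
        bond (FermionTorus.ofTorusSite x) (FermionTorus.ofTorusSite (x + Torus.proj 4 e)) := rfl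
  rw [hdef, Finset.sum_insert h00, unitSteps, Finset.sum_insert h01, Finset.sum_insert h02,
    Finset.sum_insert h03, Finset.sum_singleton, dWaveFormFactor_zero, g1, g2, g3, g4]
  push_cast
  module

/-- A site sum of bond pairs along a fixed step is the sum over the set of its ordered bonds.
[folklore] -/
theorem sum_bond_step_eq_sum_image (e : Site 2) :
    ∑ x : TorusSite 2 4, bond (FermionTorus.ofTorusSite x)
        (FermionTorus.ofTorusSite (x + Torus.proj 4 e)) =
      ∑ p ∈ Finset.univ.image (fun x : TorusSite 2 4 =>
          (FermionTorus.ofTorusSite x, FermionTorus.ofTorusSite (x + Torus.proj 4 e))),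
        bond (Prod.fst p) (Prod.snd p) := by
  have hinj : Function.Injective (FermionTorus.ofTorusSite : TorusSite 2 4 → FermionTorus 2 4) :=
    (FermionTorus.equivTorusSite (d := 2) (L := 4)).symm.injective
  rw [Finset.sum_image]
  intro x _ y _ h
  exact hinj (congrArg Prod.fst h)

/-- **The `d_{x²-y²}` pair field of the `4 × 4` torus in hypercube-direction form**:
`Δ_d = (1/√2) · ((D₁ + D₂) - (D₃ + D₄))`, `D_i` the sum of the singlet bond pairs over the
ordered bonds of direction `i` (`X₁` = `x`-inter, `X₂` = `x`-intra, `Y₁` = `y`-inter,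
`Y₂` = `y`-intra). [cite: Scalapino1995, §2 eq. (2.2)–(2.3)] -/
theorem pairField_dWave_four_eq :
    pairField dWaveFormFactor 4 = ((1 / Real.sqrt 2 : ℝ) : ℂ) •
      ((∑ p ∈ X₁, bond (Prod.fst p) (Prod.snd p) + ∑ p ∈ X₂, bond (Prod.fst p) (Prod.snd p)) -
        (∑ p ∈ Y₁, bond (Prod.fst p) (Prod.snd p) + ∑ p ∈ Y₂, bond (Prod.fst p) (Prod.snd p))) := by
  rw [pairField, Finset.sum_congr rfl (fun x _ => localPair_dWave_four_eq x), Finset.sum_sub_distrib,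
    ← Finset.smul_sum, ← Finset.smul_sum, Finset.sum_add_distrib, Finset.sum_add_distrib,
    sum_bond_step_eq_sum_image, sum_bond_step_eq_sum_image, sum_bond_step_eq_sum_image,
    sum_bond_step_eq_sum_image, smul_sub]
  have hX : ∑ p ∈ Finset.univ.image (fun x : TorusSite 2 4 =>
          (FermionTorus.ofTorusSite x, FermionTorus.ofTorusSite (x + Torus.proj 4 (Pi.single 0 1)))),
        bond (Prod.fst p) (Prod.snd p) +
      ∑ p ∈ Finset.univ.image (fun x : TorusSite 2 4 =>
          (FermionTorus.ofTorusSite x, FermionTorus.ofTorusSite (x + Torus.proj 4 (-Pi.single 0 1)))),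
        bond (Prod.fst p) (Prod.snd p) =
      ∑ p ∈ X₁, bond (Prod.fst p) (Prod.snd p) + ∑ p ∈ X₂, bond (Prod.fst p) (Prod.snd p) := by
    rw [← Finset.sum_union (by decide), ← Finset.sum_union (by decide)]
    exact Finset.sum_congr (by decide) fun _ _ => rfl
  have hY : ∑ p ∈ Finset.univ.image (fun x : TorusSite 2 4 =>
          (FermionTorus.ofTorusSite x, FermionTorus.ofTorusSite (x + Torus.proj 4 (Pi.single 1 1)))),
        bond (Prod.fst p) (Prod.snd p) +
      ∑ p ∈ Finset.univ.image (fun x : TorusSite 2 4 =>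
          (FermionTorus.ofTorusSite x, FermionTorus.ofTorusSite (x + Torus.proj 4 (-Pi.single 1 1)))),
        bond (Prod.fst p) (Prod.snd p) =
      ∑ p ∈ Y₁, bond (Prod.fst p) (Prod.snd p) + ∑ p ∈ Y₂, bond (Prod.fst p) (Prod.snd p) := by
    rw [← Finset.sum_union (by decide), ← Finset.sum_union (by decide)]
    exact Finset.sum_congr (by decide) fun _ _ => rfl
  rw [hX, hY]

/-- **No `d`-wave transition amplitude between non-degenerate floors on the `4 × 4` torus.** If the
half-filled `(16, S^z=0)` floor and the two-hole `(14, S^z=0)` floor of `hubbardTorus 2 4 t U` are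
both non-degenerate, then `⟨φ₂, Δ_d φ₀⟩ = 0` for their vectors: both are eigenvectors of the Fock
unitaries of the bit swaps `gA, gB, gC` (symmetries of `H`, transporting sector ground states),
so the four direction amplitudes `F_i = ⟨φ₂, D_i φ₀⟩` transform by scalars under the
transpositions `(2 3)`, `(1 4)`, `(1 2)` of the directions (`dotProduct_mulVec_eq_of_fockRelabel_eigen`,
`relabel_mapEquiv_sum_bond` and the `decide`d images of the bond classes), and
`dWave_combination_eq_zero` gives `F₁ + F₂ - F₃ - F₄ = 0`. [cite: TsaiYaoLauchliKivelson2008, p. 5] -/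
theorem pairField_dWave_amplitude_eq_zero_four (t U : ℝ) {φ₀ φ₂ : Fock (Orb (FermionTorus 2 4))}
    (huniq₀ : ∀ φ φ', IsGroundStateInSector (hubbardTorus 2 4 t U) (4 ^ 2) 0 φ →
      IsGroundStateInSector (hubbardTorus 2 4 t U) (4 ^ 2) 0 φ' → ∃ a : ℂ, φ' = a • φ)
    (huniq₂ : ∀ φ φ', IsGroundStateInSector (hubbardTorus 2 4 t U) (4 ^ 2 - 2) 0 φ →
      IsGroundStateInSector (hubbardTorus 2 4 t U) (4 ^ 2 - 2) 0 φ' → ∃ a : ℂ, φ' = a • φ)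
    (h₀ : IsGroundStateInSector (hubbardTorus 2 4 t U) (4 ^ 2) 0 φ₀)
    (h₂ : IsGroundStateInSector (hubbardTorus 2 4 t U) (4 ^ 2 - 2) 0 φ₂) :
    star φ₂ ⬝ᵥ (pairField dWaveFormFactor 4 *ᵥ φ₀) = 0 := by
  -- the three bit swaps are symmetries of `H`
  have hHa : relabel (Orb.mapEquiv gA) (hubbardTorus 2 4 t U) = hubbardTorus 2 4 t U :=
    relabel_hamiltonian _ _ gA ga_adj_iff t U
  have hHb : relabel (Orb.mapEquiv gB) (hubbardTorus 2 4 t U) = hubbardTorus 2 4 t U :=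
    relabel_hamiltonian _ _ gB gb_adj_iff t U
  have hHc : relabel (Orb.mapEquiv gC) (hubbardTorus 2 4 t U) = hubbardTorus 2 4 t U :=
    relabel_hamiltonian _ _ gC gc_adj_iff t U
  -- non-degenerate floors are eigenvectors of the three unitaries
  obtain ⟨la, hla⟩ := exists_eigenvalue_of_groundStates_smul huniq₀
    (fun φ hφ => hφ.fockRelabel_mapEquiv_mulVec gA hHa) h₀
  obtain ⟨ma, hma⟩ := exists_eigenvalue_of_groundStates_smul huniq₂
    (fun φ hφ => hφ.fockRelabel_mapEquiv_mulVec gA hHa) h₂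
  obtain ⟨lb, hlb⟩ := exists_eigenvalue_of_groundStates_smul huniq₀
    (fun φ hφ => hφ.fockRelabel_mapEquiv_mulVec gB hHb) h₀
  obtain ⟨mb, hmb⟩ := exists_eigenvalue_of_groundStates_smul huniq₂
    (fun φ hφ => hφ.fockRelabel_mapEquiv_mulVec gB hHb) h₂
  obtain ⟨lc, hlc⟩ := exists_eigenvalue_of_groundStates_smul huniq₀
    (fun φ hφ => hφ.fockRelabel_mapEquiv_mulVec gC hHc) h₀
  obtain ⟨mc, hmc⟩ := exists_eigenvalue_of_groundStates_smul huniq₂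
    (fun φ hφ => hφ.fockRelabel_mapEquiv_mulVec gC hHc) h₂
  -- the transformation laws of the four direction amplitudes
  have a1 := dotProduct_mulVec_eq_of_fockRelabel_eigen (Orb.mapEquiv gA) (∑ p ∈ X₁, bond (Prod.fst p) (Prod.snd p)) hla hma
  have a4 := dotProduct_mulVec_eq_of_fockRelabel_eigen (Orb.mapEquiv gA) (∑ p ∈ Y₂, bond (Prod.fst p) (Prod.snd p)) hla hma
  have a2 := dotProduct_mulVec_eq_of_fockRelabel_eigen (Orb.mapEquiv gA) (∑ p ∈ X₂, bond (Prod.fst p) (Prod.snd p)) hla hma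
  have a3 := dotProduct_mulVec_eq_of_fockRelabel_eigen (Orb.mapEquiv gA) (∑ p ∈ Y₁, bond (Prod.fst p) (Prod.snd p)) hla hma
  have b2 := dotProduct_mulVec_eq_of_fockRelabel_eigen (Orb.mapEquiv gB) (∑ p ∈ X₂, bond (Prod.fst p) (Prod.snd p)) hlb hmb
  have b1 := dotProduct_mulVec_eq_of_fockRelabel_eigen (Orb.mapEquiv gB) (∑ p ∈ X₁, bond (Prod.fst p) (Prod.snd p)) hlb hmb
  have b4 := dotProduct_mulVec_eq_of_fockRelabel_eigen (Orb.mapEquiv gB) (∑ p ∈ Y₂, bond (Prod.fst p) (Prod.snd p)) hlb hmb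
  have c1 := dotProduct_mulVec_eq_of_fockRelabel_eigen (Orb.mapEquiv gC) (∑ p ∈ X₁, bond (Prod.fst p) (Prod.snd p)) hlc hmc
  have c2 := dotProduct_mulVec_eq_of_fockRelabel_eigen (Orb.mapEquiv gC) (∑ p ∈ X₂, bond (Prod.fst p) (Prod.snd p)) hlc hmc
  rw [relabel_mapEquiv_sum_bond] at a1 a2 a3 a4 b1 b2 b4 c1 c2
  rw [ga_map_X₁] at a1; rw [ga_map_X₂] at a2; rw [ga_map_Y₁] at a3; rw [ga_map_Y₂] at a4
  rw [gb_map_X₁] at b1; rw [gb_map_X₂] at b2; rw [gb_map_Y₂] at b4; rw [gc_map_X₁] at c1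
  rw [gc_map_X₂] at c2
  have hcomb := dWave_combination_eq_zero a1 a4 a2 a3 b2 b1 b4 c1 c2
  rw [pairField_dWave_four_eq, smul_mulVec, dotProduct_smul, sub_mulVec, add_mulVec, add_mulVec,
    dotProduct_sub, dotProduct_add, dotProduct_add]
  rw [show ∀ A B C D : ℂ, A + B - (C + D) = A + B - C - D from fun A B C D => by ring, hcomb, smul_zero]

/-- **The Cooper-pair package is identically false on the `4 × 4` torus.** For every hopping `t`,
every coupling `U`, every `ε` and every `z > 0`, the route's package `CP 4 (hubbardTorus 2 4 t U) ε z`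
(written out verbatim) fails: clause (c) with `z > 0` makes the half-filled floor non-degenerate
(`halfFilled_groundStates_smul_of_cooperPackage`), clause (b) makes the two-hole floor
non-degenerate, both floors are non-empty (`szSector_groundState`), and then
`pairField_dWave_amplitude_eq_zero_four` contradicts clause (c). [cite: TsaiYaoLauchliKivelson2008, p. 5] -/
theorem not_cooperPackage_four' (t U ε : ℝ) {z : ℝ} (hz : 0 < z) :
    ¬ ((hubbardTorus 2 4 t U).minEnergyOn (szSector (4 ^ 2 - 2) 0) +
          (hubbardTorus 2 4 t U).minEnergyOn (szSector (4 ^ 2) 0) + ε ≤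
        2 * (hubbardTorus 2 4 t U).minEnergyOn (szSector (4 ^ 2 - 1) (1 / 2)) ∧
      (∀ φ₁ φ₂, IsGroundStateInSector (hubbardTorus 2 4 t U) (4 ^ 2 - 2) 0 φ₁ →
        IsGroundStateInSector (hubbardTorus 2 4 t U) (4 ^ 2 - 2) 0 φ₂ → ∃ c : ℂ, φ₂ = c • φ₁) ∧
      (∀ φ₀ φ₂, IsGroundStateInSector (hubbardTorus 2 4 t U) (4 ^ 2) 0 φ₀ →
        IsGroundStateInSector (hubbardTorus 2 4 t U) (4 ^ 2 - 2) 0 φ₂ →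
          z * ((4 : ℕ) : ℝ) ^ 2 * (star φ₀ ⬝ᵥ φ₀).re * (star φ₂ ⬝ᵥ φ₂).re ≤
            ‖star φ₂ ⬝ᵥ (pairField dWaveFormFactor 4 *ᵥ φ₀)‖ ^ 2)) := by
  rintro ⟨-, huniq₂, hamp⟩
  have hcard : Fintype.card (FermionTorus 2 4) = 16 := by
    simp only [FermionTorus, Fintype.card_lex, Fintype.card_fun, Fintype.card_fin]; norm_num
  obtain ⟨⟨φ₂, h₂⟩, -⟩ := szSector_groundState (fermionTorusGraph 2 4) t U (n := 7) (by rw [hcard]; norm_num)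
  obtain ⟨⟨φ₀, h₀⟩, -⟩ := szSector_groundState (fermionTorusGraph 2 4) t U (n := 8) (by rw [hcard]; norm_num)
  have h₂' : IsGroundStateInSector (hubbardTorus 2 4 t U) (4 ^ 2 - 2) 0 φ₂ := h₂
  have h₀' : IsGroundStateInSector (hubbardTorus 2 4 t U) (4 ^ 2) 0 φ₀ := h₀
  have huniq₀ := halfFilled_groundStates_smul_of_cooperPackage (L := 4) hz h₂' hamp
  have hA := pairField_dWave_amplitude_eq_zero_four t U huniq₀ huniq₂ h₀' h₂'
  have h1 := hamp φ₀ φ₂ h₀' h₂'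
  rw [hA, norm_zero, zero_pow two_ne_zero] at h1
  have hpos₀ : 0 < (star φ₀ ⬝ᵥ φ₀).re := (Complex.pos_iff.1 (dotProduct_star_self_pos_iff.2 h₀'.2.1)).1
  have hpos₂ : 0 < (star φ₂ ⬝ᵥ φ₂).re := (Complex.pos_iff.1 (dotProduct_star_self_pos_iff.2 h₂'.2.1)).1
  have : 0 < z * ((4 : ℕ) : ℝ) ^ 2 * (star φ₀ ⬝ᵥ φ₀).re * (star φ₂ ⬝ᵥ φ₂).re := by positivity
  linarith

/-- **The threshold of the package along the family `L = 4k + 4` is at least `1`.** If the route's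
package holds with `z > 0` for `hubbardTorus 2 (4k+4) t U` for all `k ≥ k₀` (the body of the
target `PureCooperPair`, and of `PureCooper U` in the line), then `k₀ ≥ 1`: the exactly
diagonalisable member `k = 0` never carries it. [cite: TsaiYaoLauchliKivelson2008, p. 5] -/
theorem cooperPackage_threshold_pos {t U ε z : ℝ} (hz : 0 < z) {k₀ : ℕ}
    (h : ∀ k ≥ k₀,
      (hubbardTorus 2 (4 * k + 4) t U).minEnergyOn (szSector ((4 * k + 4) ^ 2 - 2) 0) +
            (hubbardTorus 2 (4 * k + 4) t U).minEnergyOn (szSector ((4 * k + 4) ^ 2) 0) + ε ≤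
          2 * (hubbardTorus 2 (4 * k + 4) t U).minEnergyOn (szSector ((4 * k + 4) ^ 2 - 1) (1 / 2)) ∧
        (∀ φ₁ φ₂, IsGroundStateInSector (hubbardTorus 2 (4 * k + 4) t U) ((4 * k + 4) ^ 2 - 2) 0 φ₁ →
          IsGroundStateInSector (hubbardTorus 2 (4 * k + 4) t U) ((4 * k + 4) ^ 2 - 2) 0 φ₂ →
            ∃ c : ℂ, φ₂ = c • φ₁) ∧
        (∀ φ₀ φ₂, IsGroundStateInSector (hubbardTorus 2 (4 * k + 4) t U) ((4 * k + 4) ^ 2) 0 φ₀ →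
          IsGroundStateInSector (hubbardTorus 2 (4 * k + 4) t U) ((4 * k + 4) ^ 2 - 2) 0 φ₂ →
            z * ((4 * k + 4 : ℕ) : ℝ) ^ 2 * (star φ₀ ⬝ᵥ φ₀).re * (star φ₂ ⬝ᵥ φ₂).re ≤
              ‖star φ₂ ⬝ᵥ (pairField dWaveFormFactor (4 * k + 4) *ᵥ φ₀)‖ ^ 2)) :
    0 < k₀ := by
  rcases Nat.eq_zero_or_pos k₀ with rfl | hpos
  · exact absurd (h 0 le_rfl) (not_cooperPackage_four' t U ε hz)
  · exact hpos

/-- **Read off the route's target by name**: the `k₀` of `PureCooperPair` is at least `1`.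
[cite: TsaiYaoLauchliKivelson2008, p. 5] -/
theorem pureCooperPair_threshold_pos
    (h : Summit.HubbardSuperconductivity.HubbardSuperconductivity.Theses.CooperPairDMottWalk.PureCooperPair) :
    ∃ U ∈ Set.Icc (2 : ℝ) 8, ∃ ε > (0 : ℝ), ∃ z > (0 : ℝ), ∃ k₀ : ℕ, 0 < k₀ ∧ ∀ k ≥ k₀,
      (hubbardTorus 2 (4 * k + 4) 1 U).minEnergyOn (szSector ((4 * k + 4) ^ 2 - 2) 0) +
            (hubbardTorus 2 (4 * k + 4) 1 U).minEnergyOn (szSector ((4 * k + 4) ^ 2) 0) + ε ≤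
          2 * (hubbardTorus 2 (4 * k + 4) 1 U).minEnergyOn (szSector ((4 * k + 4) ^ 2 - 1) (1 / 2)) ∧
        (∀ φ₁ φ₂, IsGroundStateInSector (hubbardTorus 2 (4 * k + 4) 1 U) ((4 * k + 4) ^ 2 - 2) 0 φ₁ →
          IsGroundStateInSector (hubbardTorus 2 (4 * k + 4) 1 U) ((4 * k + 4) ^ 2 - 2) 0 φ₂ →
            ∃ c : ℂ, φ₂ = c • φ₁) ∧
        (∀ φ₀ φ₂, IsGroundStateInSector (hubbardTorus 2 (4 * k + 4) 1 U) ((4 * k + 4) ^ 2) 0 φ₀ →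
          IsGroundStateInSector (hubbardTorus 2 (4 * k + 4) 1 U) ((4 * k + 4) ^ 2 - 2) 0 φ₂ →
            z * ((4 * k + 4 : ℕ) : ℝ) ^ 2 * (star φ₀ ⬝ᵥ φ₀).re * (star φ₂ ⬝ᵥ φ₂).re ≤
              ‖star φ₂ ⬝ᵥ (pairField dWaveFormFactor (4 * k + 4) *ᵥ φ₀)‖ ^ 2) := by
  obtain ⟨U, hU, ε, hε, z, hz, k₀, hK⟩ := h
  exact ⟨U, hU, ε, hε, z, hz, k₀, cooperPackage_threshold_pos hz hK, hK⟩

end Four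

/-! ### The registered sub-goal stub (verbatim signature) -/

/-- **Registered sub-goal stub `not_cooperPackage_four`** of the line `registered` for the crux
`BindingWalk` (bears on `stub_dWaveSelection` / the target `PureCooperPair`): the route's
Cooper-pair package is false on the `4 × 4` torus for every `t`, `U`, `ε` and every `z > 0`.
(`not_cooperPackage_four'` in binder form.) [cite: TsaiYaoLauchliKivelson2008, p. 5] -/
theorem not_cooperPackage_four : ∀ (t U ε : ℝ) {z : ℝ}, 0 < z → ¬ ((hubbardTorus 2 4 t U).minEnergyOn (szSector (4 ^ 2 - 2) 0) + (hubbardTorus 2 4 t U).minEnergyOn (szSector (4 ^ 2) 0) + ε ≤ 2 * (hubbardTorus 2 4 t U).minEnergyOn (szSector (4 ^ 2 - 1) (1 / 2)) ∧ (∀ φ₁ φ₂, IsGroundStateInSector (hubbardTorus 2 4 t U) (4 ^ 2 - 2) 0 φ₁ → IsGroundStateInSector (hubbardTorus 2 4 t U) (4 ^ 2 - 2) 0 φ₂ → ∃ c : ℂ, φ₂ = c • φ₁) ∧ (∀ φ₀ φ₂, IsGroundStateInSector (hubbardTorus 2 4 t U) (4 ^ 2) 0 φ₀ → IsGroundStateInSector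 (hubbardTorus 2 4 t U) (4 ^ 2 - 2) 0 φ₂ → z * ((4 : ℕ) : ℝ) ^ 2 * (star φ₀ ⬝ᵥ φ₀).re * (star φ₂ ⬝ᵥ φ₂).re ≤ ‖star φ₂ ⬝ᵥ (pairField dWaveFormFactor 4 *ᵥ φ₀)‖ ^ 2)) :=
  fun t U ε _ hz => not_cooperPackage_four' t U ε hz

end Summit.HubbardSuperconductivity.HubbardSuperconductivity.Theorems.CooperPairDMottWalk

end
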